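import Mathlib
import Summits.Langlands.Langlands.Theorems.QuadraticWindowHostInducedRepMemberSatakeObjects
import Summits.Langlands.Langlands.Theorems.QuadraticWindowHostInducedRepMemberSatakeDual
import Summits.Langlands.Langlands.Theorems.QuadraticWindowHostInducedRepMemberSatakePane

/-!
# Sub-stub `stub_memberSatake` of the member statement of stub `stub_package`, line
# `one-transparent-pane` (crux `Summit.Langlands.Langlands.Theses.QuadraticWindow.HostInducedRep`,
# item stmt-Langlands-10902): `τ' = AI_{L/K}(P)` a.e. and the ASSEMBLY of the registered signature

LOG (wave-3 worker `stub_memberSatake`, 2026-08-16).  Proves the registered signature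
`theorem stub_memberSatake : …` verbatim; the three facts `hAI` (named,
`automorphicInduction_cyclic_cuspidal_unramified`), `hBC` (placewise cuspidal prime-degree cyclic base
change), `hext` (extension of unitary idele class characters along `K/F₀` with prescribed
unramifiedness) are HYPOTHESES inside the statement; no definition, no new fact.  Helper files
(all landed `--supports stmt-Langlands-10902`, FACT-FREE):

1. `…MemberSatakeKlein.lean` — places in the biquadratic pane tower: `Gal(L/F₀)` is the Klein group,
   no residue degree `4` at an unramified place, the generator `t` of `Gal(L/K)` acts by `τ` on `F`,
   `(σ𝔓) ∩ F = ρ(𝔓 ∩ F)`, residue degrees under the pane automorphisms;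
2. `…MemberSatakeObjects.lean` — the OBJECTS (`χ₀ = (χe ω₀)⁻¹ μ`, `ψu` by `hext` on a `cK`-admissible
   set of places, `νk = ‖·‖^{k/2}`, `ν = ‖·‖^{-n/2}`, `Pind = AI(π ⊗ ω)` by `hAI`, `PiK = BC_{K/F₀}(Pind)` and
   `P₀ = BC_{L/F}(π ⊗ ω)` by `hBC`, `τ' = PiK ⊗ ψ₀`, `P = P₀ ⊗ (ψ₀ ∘ N_{L/K})`), the relations `MemberRel`,
   and the COVERAGE clause of the dictionary (strong base change at the chosen split place);
3. `…MemberSatakeData.lean` — the a.e. Satake data over `F₀` (induced parameter `B_v`, its polarization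
   `B_v⁻¹ = B_v θ_v` from the landed `inducedParam_map_inv`, restriction identities);
4. `…MemberSatakeDual.lean` — `τ'` conjugate self-dual a.e. w.r.t. `cK` (`ψ₀ψ₀^c = θ μ ∘ N`, `B = -B` at
   the `F`-inert places) and the dictionary a.e. (landed `dictionary_powers`);
5. `…MemberSatakePane.lean` — `Sat(P, 𝔓)` and `P` conjugate self-dual a.e. w.r.t. `s`
   (the scalar identity `μ(ϖ_v)^{f(𝔓|v)} = 1`).

This file: §1 `isAutomorphicInductionAlong_pane` — for almost every place `u` of `K` (over `v` of
`F₀`), the Satake parameter `B_v^{f(u|v)} ψ₀(ϖ_u)` of `τ'` at `u` has Satake polynomial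
`∏_{𝔓 ∣ u} P_{Sat(P,𝔓)}(X^{f(𝔓|u)})`, i.e. `IsAutomorphicInductionAlong P τ'` (Arthur–Clozel Def. 6.1
along `L/K`; Mackey in the Klein tower).  With `𝔓₀ ∣ u`, `w₀ = 𝔓₀ ∩ F`, `A'_w = Sat(π ⊗ ω, w)` and the
generator `t` of `Gal(L/K)`, the places above `u` are `{𝔓₀, t𝔓₀}` and, case by case:
`t𝔓₀ ≠ 𝔓₀`, `u ≠ cK u`: `B_v = A'_{w₀} + A'_{τw₀}`; `t𝔓₀ ≠ 𝔓₀`, `u = cK u`, `τw₀ ≠ w₀`: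
`B_v² = A'_{w₀}² + A'_{τw₀}²`; `t𝔓₀ ≠ 𝔓₀`, `u = cK u`, `τw₀ = w₀`: `B_v² = 2·A'_{w₀}`; `t𝔓₀ = 𝔓₀`: `τw₀ = w₀`,
`f(𝔓₀|w₀) = 1` (no residue degree `4`), `u ≠ cK u`, `P_{B_v ψ₀(ϖ_u)}(X) = P_{A'_{w₀} ψ₀(ϖ_u)²}(X²)`.
§2 the assembly `stub_memberSatake` (= registered signature) and its fact-free core
`satakeOut_of_memberRel`.
[cite: ArthurClozelAMS120, Ch. 3 Thm. 4.2, 5.1, 6.2 and Def. 6.1]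
-/

open scoped BigOperators Polynomial Classical
open Filter Set Polynomial IsDedekindDomain NumberField
open Literature.NumberTheory.Automorphic Literature.NumberTheory.GaloisRepresentations
open Literature.NumberTheory.GaloisRepresentations.QuadraticFamily
open Literature.NumberTheory.Automorphic.PatchingFamily
open Literature.NumberTheory.QuadraticForms Literature.NumberTheory.QuadraticForms.QuadraticExtension
open Summit.Langlands.Langlands.Theorems.HostInducedRep.GrsExplicitDescent
open Summit.Langlands.Langlands.Theorems.HostInducedRep.Negative

-- `Summit.Langlands.Langlands.…` (summit = sub-problem name, D-0017 layout) trips `dupNamespace`.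
set_option linter.dupNamespace false

noncomputable section

namespace Summit.Langlands.Langlands.Theorems.HostInducedRep.OneTransparentPane

/-! ## §1 Automorphic induction along `L/K` almost everywhere -/


section PaneAI

variable {F₀ F K L F' : Type} [Field F₀] [NumberField F₀] [Field F] [NumberField F] [Field K]
  [NumberField K] [Field L] [NumberField L] [Field F'] [NumberField F'] [Algebra F₀ F] [Algebra F₀ K]
  [Algebra F₀ L] [Algebra F L] [Algebra K L] [Algebra F' L] [IsScalarTower F₀ F L] [IsScalarTower F₀ K L]
  [IsGalois K L]

/-- **`τ' = AI_{L/K}(P)` almost everywhere** (see the module docstring).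
[cite: ArthurClozelAMS120, Ch. 3 Def. 6.1, (6.1)–(6.2)] -/
theorem isAutomorphicInductionAlong_pane (hdeg : Module.finrank F₀ F = 2) {τ : F ≃ₐ[F₀] F} (hτ : τ ≠ 1)
    (h2K : Module.finrank F₀ K = 2) {cK : K ≃ₐ[F₀] K} (hcK : cK ≠ 1) {s : L ≃ₐ[F'] L}
    (hT : IsPaneTower τ cK L F' s) {n : ℕ} {hcpt : isCompact_glFiniteIntegralLevel n F}
    (π : CuspidalAutomorphicRepData n F hcpt) (e : FramedGaloisRep F₀ ℂ 1) (k : ℤ)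
    (hpol : ∀ᶠ w in cofinite, ∀ (α β : Multiset ℂ) (c : ℂ), π.1.HasSatakeParamAt w α →
      π.1.HasSatakeParamAt (τ • w) β → e.HasFrobCharpolyAt (w.under (𝓞 F₀)) (X - C c) →
      β = α.map (fun a ↦ a⁻¹ * (c * ((w.under (𝓞 F₀)).residueCard : ℂ) ^ k) ^
        w.asIdeal.inertiaDeg (𝓞 F₀)))
    {χe μ ω₀ : HeckeCharacter F₀} {ω : HeckeCharacter F} (hfin : ω.IsFiniteOrder)
    (hχe : ∀ v : HeightOneSpectrum (𝓞 F₀), e.IsUnramifiedAt v →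
      χe.IsUnramifiedAt v ∧ e.HasFrobCharpolyAt v (X - C (χe.valueAtUniformizer v)))
    (hω₀ : ∀ x, ω₀ x = ω (AdeleRing.ideleBaseChange F₀ F x)) (hμ : MuHyp F K μ)
    {ψu νk : HeckeCharacter K}
    (hψures : ∀ x, ψu (AdeleRing.ideleBaseChange F₀ K x) = ((χe * ω₀)⁻¹ * μ) x)
    {hF₀ : isCompact_glFiniteIntegralLevel (2 * n) F₀} {hK : isCompact_glFiniteIntegralLevel (2 * n) K}
    {hL : isCompact_glFiniteIntegralLevel n L}
    {Pind : AutomorphicRepData (AutomorphyDatum.gl (2 * n) F₀ hF₀)}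
    {PiK τ' : AutomorphicRepData (AutomorphyDatum.gl (2 * n) K hK)}
    {P₀ P : AutomorphicRepData (AutomorphyDatum.gl n L hL)}
    (hAI : IsAutomorphicInductionAlong (π.twist ω hfin).1 Pind) (hBC : IsWeakBaseChangeLiftAE Pind PiK)
    (hW : τ'.W = PiK.W.map (mulChar (detTwist (2 * n) (ψu * νk))))
    (hW' : τ'.W' = PiK.W'.map (mulChar (detTwist (2 * n) (ψu * νk))))
    (hP₀ : IsWeakBaseChangeLiftAE (π.twist ω hfin).1 P₀)
    (hPW : P.W = P₀.W.map (mulChar (detTwist n ((ψu * νk).compRelNorm L))))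
    (hPW' : P.W' = P₀.W'.map (mulChar (detTwist n ((ψu * νk).compRelNorm L)))) :
    IsAutomorphicInductionAlong P τ' := by
  obtain ⟨t, ht, htF, h4⟩ := exists_paneGen hdeg hτ h2K hcK hT
  obtain ⟨hFL, hKL, -, -, -, -, -, -⟩ := hT
  haveI : Algebra.IsQuadraticExtension F L := ⟨hFL⟩
  haveI : IsGalois F L := Algebra.IsQuadraticExtension.isGalois F L
  haveI : Algebra.IsQuadraticExtension F₀ K := ⟨h2K⟩
  haveI : IsGalois F₀ K := Algebra.IsQuadraticExtension.isGalois F₀ K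
  have htF₀ : ∀ z : F₀, t (algebraMap F₀ L z) = algebraMap F₀ L z := fun z ↦ by
    rw [IsScalarTower.algebraMap_apply F₀ K L, AlgEquiv.commutes]
  have hD := eventually_paneData hdeg hτ π e k hpol hfin hχe hω₀ hμ hψures hAI hBC hW hW' hP₀ hPW hPW'
  change ∀ᶠ u : HeightOneSpectrum (𝓞 K) in cofinite, ∀ β : HeightOneSpectrum (𝓞 L) → Multiset ℂ,
    (∀ 𝔓 : HeightOneSpectrum (𝓞 L), 𝔓.asIdeal.under (𝓞 K) = u.asIdeal → P.HasSatakeParamAt 𝔓 (β 𝔓)) →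
      ∃ α' : Multiset ℂ, τ'.HasSatakeParamAt u α' ∧ satakePolynomial α' = inducedSatakePolynomial u β
  filter_upwards [eventually_under (E := K) (F := F₀) hD] with u hu β hβ
  obtain ⟨α, B, ⟨hv1, hv2, -, -, hBi, -, -, -, -, hKu, -, -⟩, hvL, hKL', hP⟩ := hu (u.under (𝓞 F₀)) rfl
  set v := u.under (𝓞 F₀) with hvdef
  obtain ⟨-, -, hτ'u⟩ := hKu u rfl
  refine ⟨_, hτ'u, ?_⟩
  obtain ⟨hunr_u, -⟩ := hKL' u rfl
  -- a place `𝔓₀` of `L` over `u`, `w₀ = 𝔓₀ ∩ F`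
  obtain ⟨𝔓₀, h𝔓₀⟩ := HeightOneSpectrum.exists_under_eq L u
  have h𝔓₀v : 𝔓₀.under (𝓞 F₀) = v := by rw [← under_under_place (F := K) 𝔓₀, h𝔓₀]
  have hw₀v : (𝔓₀.under (𝓞 F)).under (𝓞 F₀) = v := (under_under_place 𝔓₀).trans h𝔓₀v
  -- `β` is the computed family above `u`
  have hβ' : ∀ 𝔓 : HeightOneSpectrum (𝓞 L), 𝔓.asIdeal.under (𝓞 K) = u.asIdeal →
      β 𝔓 = (((α (𝔓.under (𝓞 F))).map (ω.valueAtUniformizer (𝔓.under (𝓞 F)) * ·)).map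
        (· ^ 𝔓.asIdeal.inertiaDeg (𝓞 F))).map
        ((ψu * νk).valueAtUniformizer u ^ 𝔓.asIdeal.inertiaDeg (𝓞 K) * ·) := by
    intro 𝔓 h
    have h' : 𝔓.under (𝓞 K) = u := (place_under_eq_iff_asIdeal 𝔓 u).mpr h
    have h𝔓v : 𝔓.under (𝓞 F₀) = v := by rw [← under_under_place (F := K) 𝔓, h']
    have hP𝔓 := hP 𝔓 h𝔓v
    rw [h'] at hP𝔓
    exact P.hasSatakeParamAt_unique_holds (hβ 𝔓 h) hP𝔓
  rw [inducedSatakePolynomial_congr u hβ']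
  have hs : (ψu * νk).valueAtUniformizer u ≠ 0 := Units.ne_zero _
  -- `f(𝔓₀|v) = f(u|v) f(𝔓₀|u) = f(w₀|v) f(𝔓₀|w₀)`
  have hf : u.asIdeal.inertiaDeg (𝓞 F₀) * 𝔓₀.asIdeal.inertiaDeg (𝓞 K) =
      (𝔓₀.under (𝓞 F)).asIdeal.inertiaDeg (𝓞 F₀) * 𝔓₀.asIdeal.inertiaDeg (𝓞 F) := by
    haveI : 𝔓₀.asIdeal.LiesOver (𝔓₀.under (𝓞 K)).asIdeal := ⟨rfl⟩
    haveI : 𝔓₀.asIdeal.LiesOver (𝔓₀.under (𝓞 F)).asIdeal := ⟨rfl⟩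
    rw [← h𝔓₀, ← Ideal.inertiaDeg_tower (𝔓₀.under (𝓞 K)).asIdeal 𝔓₀.asIdeal,
      ← Ideal.inertiaDeg_tower (𝔓₀.under (𝓞 F)).asIdeal 𝔓₀.asIdeal]
  by_cases ht𝔓 : t • 𝔓₀ = 𝔓₀
  · -- ONE place over `u` (`f(𝔓₀|u) = 2`): then `τ w₀ = w₀`, `f(𝔓₀|w₀) = 1`, `f(u|v) = 1`
    have hfu : 𝔓₀.asIdeal.inertiaDeg (𝓞 K) = 2 :=
      inertiaDeg_eq_two_of_smul_eq_of_isUnramifiedIn hKL ht ht𝔓 (by rw [h𝔓₀]; exact hunr_u)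
    obtain ⟨hτw₀, hfF, hfw⟩ := pane_inertiaDeg_F_eq_one hdeg hτ hFL htF h4 ht𝔓
      (by rw [h𝔓₀v]; exact hvL) (by rw [h𝔓₀v]; exact hv1)
    have hfK : u.asIdeal.inertiaDeg (𝓞 F₀) = 1 := by
      rw [hfu, hfF, hfw] at hf
      omega
    have hfib : ∀ 𝔓 : HeightOneSpectrum (𝓞 L), 𝔓.under (𝓞 K) = u ↔ 𝔓 = 𝔓₀ := fun 𝔓 ↦
      ⟨fun h ↦ by
        rcases HeightOneSpectrum.eq_or_eq_smul_of_under_eq hKL ht (h.trans h𝔓₀.symm) with h1 | h1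
        · exact h1
        · rw [h1, ht𝔓], fun h ↦ h ▸ h𝔓₀⟩
    rw [inducedSatakePolynomial_single hfib, hfu, hfw, hfK]
    obtain ⟨-, -, hcomp⟩ := induced_inert hdeg hτ hw₀v hτw₀ hv1 hBi
    have key := satakePolynomial_map_mul_of_comp two_pos hcomp hs
    rw [show (B.map (· ^ 1)).map ((ψu * νk).valueAtUniformizer u * ·) =
          B.map (· * (ψu * νk).valueAtUniformizer u) by
        rw [Multiset.map_map]
        exact Multiset.map_congr rfl fun b _ ↦ by simp [mul_comm],
      show (((α (𝔓₀.under (𝓞 F))).map (ω.valueAtUniformizer (𝔓₀.under (𝓞 F)) * ·)).map (· ^ 1)).map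
          ((ψu * νk).valueAtUniformizer u ^ 2 * ·) =
        ((α (𝔓₀.under (𝓞 F))).map (ω.valueAtUniformizer (𝔓₀.under (𝓞 F)) * ·)).map
          (· * (ψu * νk).valueAtUniformizer u ^ 2) by
        rw [Multiset.map_map]
        exact Multiset.map_congr rfl fun b _ ↦ by simp [mul_comm], key]
  · -- TWO places `𝔓₀ ≠ t𝔓₀` over `u` (`f = 1` over `u`), `t𝔓₀ ∩ F = τ w₀`
    have hfu : 𝔓₀.asIdeal.inertiaDeg (𝓞 K) = 1 := HeightOneSpectrum.inertiaDeg_eq_one_of_smul_ne hKL ht𝔓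
    have hfu' : (t • 𝔓₀).asIdeal.inertiaDeg (𝓞 K) = 1 := by
      rw [HeightOneSpectrum.inertiaDeg_algEquiv_smul, hfu]
    have ht𝔓w : (t • 𝔓₀).under (𝓞 F) = τ • 𝔓₀.under (𝓞 F) := under_smul_of_comm htF 𝔓₀
    have hfw' : (t • 𝔓₀).asIdeal.inertiaDeg (𝓞 F) = 𝔓₀.asIdeal.inertiaDeg (𝓞 F) :=
      inertiaDeg_F_smul_of_comm htF₀ htF 𝔓₀
    have hfib : ∀ 𝔓 : HeightOneSpectrum (𝓞 L), 𝔓.under (𝓞 K) = u ↔ (𝔓 = 𝔓₀ ∨ 𝔓 = t • 𝔓₀) := fun 𝔓 ↦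
      ⟨fun h ↦ HeightOneSpectrum.eq_or_eq_smul_of_under_eq hKL ht (h.trans h𝔓₀.symm), by
        rintro (rfl | rfl)
        · exact h𝔓₀
        · rw [HeightOneSpectrum.under_algEquiv_smul, h𝔓₀]⟩
    rw [inducedSatakePolynomial_pair (Ne.symm ht𝔓) hfib, hfu, hfu', ht𝔓w, hfw']
    simp only [pow_one, comp_X]
    rw [← satakePolynomial_add, ← Multiset.map_add]
    congr 2
    rw [hfu, mul_one] at hf
    by_cases hcu : cK • u = u
    · have hfK : u.asIdeal.inertiaDeg (𝓞 F₀) = 2 := inertiaDeg_eq_two_of_smul_eq_of_isUnramifiedIn h2K hcK hcu hv2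
      by_cases hτw₀ : τ • 𝔓₀.under (𝓞 F) = 𝔓₀.under (𝓞 F)
      · -- `v` inert in `F`: `B²` is twice `A'_{w₀}`
        obtain ⟨-, hfF, hcomp⟩ := induced_inert hdeg hτ hw₀v hτw₀ hv1 hBi
        have hfw : 𝔓₀.asIdeal.inertiaDeg (𝓞 F) = 1 := by
          rw [hfK, hfF] at hf
          omega
        have hcomp' : satakePolynomial B = ∏ i ∈ ({𝔓₀.under (𝓞 F)} : Finset (HeightOneSpectrum (𝓞 F))),
            (satakePolynomial ((α i).map (ω.valueAtUniformizer i * ·))).comp (X ^ 2) := by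
          rw [Finset.prod_singleton, hcomp]
        have h2 := Multiset.map_pow_eq_nsmul_sum_of_satakePolynomial_eq {𝔓₀.under (𝓞 F)}
          (fun i ↦ (α i).map (ω.valueAtUniformizer i * ·)) two_pos hcomp'
        rw [Finset.sum_singleton] at h2
        rw [hfK, hfw, hτw₀, h2, two_nsmul]
        simp
      · -- `v` split in `F`: `B = A'_{w₀} + A'_{τw₀}`, `f(𝔓₀|w₀) = 2`
        obtain ⟨-, -, hfF, -, hBsum⟩ := induced_split hdeg hτ hw₀v hτw₀ hBi
        have hfw : 𝔓₀.asIdeal.inertiaDeg (𝓞 F) = 2 := by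
          rw [hfK, hfF] at hf
          omega
        rw [hfK, hfw, hBsum, Multiset.map_add]
    · -- `v` totally split: `B = A'_{w₀} + A'_{τw₀}`, all residue degrees `1`
      have hfK : u.asIdeal.inertiaDeg (𝓞 F₀) = 1 := HeightOneSpectrum.inertiaDeg_eq_one_of_smul_ne h2K hcu
      rw [hfK] at hf
      have hfF := Nat.eq_one_of_mul_eq_one_right hf.symm
      have hfw := Nat.eq_one_of_mul_eq_one_left hf.symm
      have hτw₀ : τ • 𝔓₀.under (𝓞 F) ≠ 𝔓₀.under (𝓞 F) := fun h ↦ by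
        have h2 := inertiaDeg_eq_two_of_smul_eq_of_isUnramifiedIn hdeg hτ h (by rw [hw₀v]; exact hv1)
        omega
      obtain ⟨-, -, -, -, hBsum⟩ := induced_split hdeg hτ hw₀v hτw₀ hBi
      rw [hfK, hfw, hBsum, Multiset.map_add]

end PaneAI

/-- **Registered anchor** `memberSatakePaneAI_anchor` (stub registry of stmt-Langlands-10902, line
`one-transparent-pane`; registered for the former separate helper "PaneAI", kept here): the induced
Satake polynomial over a two-place fibre. [folklore] -/
theorem memberSatakePaneAI_anchor : ∀ (F₀ M : Type) [Field F₀] [Field M] [Algebra F₀ M] (v : HeightOneSpectrum (𝓞 F₀)) (w₀ w₁ : HeightOneSpectrum (𝓞 M)), w₀ ≠ w₁ → (∀ w : HeightOneSpectrum (𝓞 M), w.under (𝓞 F₀) = v ↔ (w = w₀ ∨ w = w₁)) → ∀ (A : HeightOneSpectrum (𝓞 M) → Multiset ℂ), inducedSatakePolynomial v A = (satakePolynomial (A w₀)).comp (X ^ w₀.asIdeal.inertiaDeg (𝓞 F₀)) * (satakePolynomial (A w₁)).comp (X ^ w₁.asIdeal.inertiaDeg (𝓞 F₀)) :=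
  fun _ _ _ _ _ _ _ _ hne hfib A ↦ inducedSatakePolynomial_pair hne hfib A


/-! ## §2 The assembly -/


/-- **Sub-stub SATAKE (`stub_memberSatake`; facts: placewise cyclic automorphic induction `hAI`,
placewise cyclic base change `hBC` (Arthur–Clozel Thm. 4.2/5.1/6.2, Henniart 2012), extension of
unitary idele class characters `hext` (Hewitt–Ross (24.12))).**  All FINITE-PLACE constructions of
the member: for the crux data, a quadratic `K/F₀` (involution `cK`) ramified at a guarded place, a
pane tower `L ⊃ F, K`, the Artin avatars `χe, ω` of `e, eψ` with `ω₀ = ω|_{F₀}`, and an admissible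
sign-twisting character `μ`: the objects `ψu` (unitary extension of `χ₀ = (χe ω₀)⁻¹ μ` to `K`,
unramified where the dictionary needs it), `νk = ‖·‖^{k/2}`, `ν = ‖·‖^{-n/2}`, `Π = AI(π ⊗ ω)`
(induced package), `Π_K = BC_{K/F₀}(Π)`, `τ' = Π_K ⊗ ψ₀` (`ψ₀ = ψu νk`), `P₀ = BC_{L/F}(π ⊗ ω)`,
`P = P₀ ⊗ (ψ₀ ∘ N_{L/K})`, all cuspidal, with the relations `MemberRel`, and the conclusions
`SatakeOut`: the dictionary (`member_dictionary`, landed), `τ'` conjugate self-dual a.e. w.r.t. `cK`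
(`inducedParam_map_inv`, landed, + `ψ₀ψ₀^c = θμ ∘ N`), `P` conjugate self-dual a.e. w.r.t. `s`,
`τ' = AI_{L/K}(P)` a.e. (Mackey in the Klein tower).
[cite: ArthurClozelAMS120, Ch. 3 Thm. 4.2, 5.1, 6.2] -/
theorem stub_memberSatake : automorphicInduction_cyclic_cuspidal_unramified → (∀ (n : ℕ) (F E : Type) [Field F] [NumberField F] [Field E] [NumberField E] [Algebra F E] [IsGalois F E], (Module.finrank F E).Prime → ∀ (hF : isCompact_glFiniteIntegralLevel n F) (π : CuspidalAutomorphicRepData n F hF), (∃ v : HeightOneSpectrum (𝓞 F), ¬ Algebra.IsUnramifiedIn (𝓞 E) v.asIdeal ∧ π.1.IsUnramifiedAt v) → ∀ (hE : isCompact_glFiniteIntegralLevel n E), ∃ P : CuspidalAutomorphicRepData n E hE, IsUnramifiedBaseChangeLift π.1 P.1) → (∀ (F₀ K : Type) [Field F₀] [NumberField F₀] [Field K] [NumberField K] [Algebra F₀ K] (c : K ≃ₐ[F₀] K), Module.finrank F₀ K = 2 → c ≠ 1 → ∀ (χ₀ : HeckeCharacter F₀), χ₀.IsUnitary → ∀ (U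 : Set (HeightOneSpectrum (𝓞 K))), (∀ u ∈ U, c • u ∈ U → χ₀.IsUnramifiedAt (u.under (𝓞 F₀))) → ∃ χ : HeckeCharacter K, χ.IsUnitary ∧ (∀ x, χ (AdeleRing.ideleBaseChange F₀ K x) = χ₀ x) ∧ ∀ u ∈ U, χ.IsUnramifiedAt u) → ∀ (F₀ F : Type) [Field F₀] [NumberField F₀] [Field F] [NumberField F] [Algebra F₀ F] (τ : F ≃ₐ[F₀] F) (n : ℕ) (hcpt : isCompact_glFiniteIntegralLevel n F) (π : CuspidalAutomorphicRepData n F hcpt) (e : FramedGaloisRep F₀ ℂ 1) (k : ℤ) (ℓ : ℕ) [Fact ℓ.Prime] (ι : PadicAlgCl ℓ ≃+* ℂ) (eψ : FramedGaloisRep F ℂ 1), Hyps τ n π e k ℓ eψ → ∀ (K : Type) [Field K] [NumberField K] [Algebra F₀ K] (cK : K ≃ₐ[F₀] K), Module.finrank F₀ K = 2 → cK ≠ 1 → (∃ v₀ : HeightOneSpectrum (𝓞 F₀), ¬ Algebra.IsUnramifiedIn (𝓞 K) v₀.asIdeal ∧ ∃ (α : HeightOneSpectrum (𝓞 F) → Multiset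 ℂ) (c : HeightOneSpectrum (𝓞 F) → ℂ), Guard π eψ v₀ α c) → ∀ (L F' : Type) [Field L] [NumberField L] [Field F'] [NumberField F'] [Algebra F₀ L] [Algebra F L] [Algebra K L] [Algebra F' L] [IsScalarTower F₀ F L] [IsScalarTower F₀ K L] [IsGalois K L] (s : L ≃ₐ[F'] L), IsPaneTower τ cK L F' s → ∀ (χe : HeckeCharacter F₀) (ω : HeckeCharacter F) (hfin : ω.IsFiniteOrder) (ω₀ : HeckeCharacter F₀), (∀ v : HeightOneSpectrum (𝓞 F₀), e.IsUnramifiedAt v → χe.IsUnramifiedAt v ∧ e.HasFrobCharpolyAt v (X - C (χe.valueAtUniformizer v))) → χe.IsFiniteOrder → (∀ w : HeightOneSpectrum (𝓞 F), eψ.IsUnramifiedAt w → ω.IsUnramifiedAt w ∧ eψ.HasFrobCharpolyAt w (X - C (ω.valueAtUniformizer w))) → (∀ x, ω₀ x = ω (AdeleRing.ideleBaseChange F₀ F x)) → ∀ (μ : HeckeCharacter F₀), MuHyp F K μ → ∃ (ψu νk ν : HeckeCharacter K) (Pind : CuspidalAutomorphicRepData (2 * n) F₀ (isCompact_glFiniteIntegralLevel_holds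 (2 * n) F₀)) (PiK τ' : CuspidalAutomorphicRepData (2 * n) K (isCompact_glFiniteIntegralLevel_holds (2 * n) K)) (P₀ P : CuspidalAutomorphicRepData n L (isCompact_glFiniteIntegralLevel_holds n L)), MemberRel π e eψ k μ χe ω hfin ω₀ ψu νk ν Pind PiK τ' P₀ P ∧ SatakeOut F₀ π ι eψ cK s τ'.1 (ψu * νk * ν) P.1 := by
  intro hAI hBC hext F₀ F _ _ _ _ _ τ n hcpt π e k ℓ _ ι eψ hH K _ _ _ cK h2K hcK hram L F' _ _ _ _ _ _ _ _ _ _ _ s hT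
    χe ω hfin ω₀ hχe hχefin hω hω₀ μ hμ
  obtain ⟨ψu, νk, ν, Pind, PiK, τ', P₀, P, hrel, -, hcov⟩ := memberSatake_objects hAI hBC hext τ n hcpt π e
    k ℓ ι eψ hH K cK h2K hcK hram L F' s hT χe ω hfin ω₀ hχe hχefin hω hω₀ μ hμ
  refine ⟨ψu, νk, ν, Pind, PiK, τ', P₀, P, hrel, ?_⟩
  obtain ⟨-, -, -, -, -, -, hψures, hνk, hν, hAIae, hBCae, hτ'W, hτ'W', hP₀BC, hPW, hPW'⟩ := hrel
  obtain ⟨-, hdeg, hτ, -, hpol, -⟩ := hH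
  exact ⟨⟨memberDict_ae π eψ ι hfin hω hνk hν hAIae hBCae hτ'W hτ'W', hcov⟩,
    isConjSelfDualAE_tau hdeg hτ h2K hcK π e k hpol hfin hχe hω₀ hμ hψures hνk hAIae hBCae hτ'W hτ'W',
    isConjSelfDualAE_pane hdeg hτ h2K hcK hT π e k hpol hfin hχe hω₀ hμ hψures hνk hAIae hBCae hτ'W hτ'W'
      hP₀BC hPW hPW',
    isAutomorphicInductionAlong_pane hdeg hτ h2K hcK hT π e k hpol hfin hχe hω₀ hμ hψures hAIae hBCae
      hτ'W hτ'W' hP₀BC hPW hPW'⟩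

/-- **Registered anchor form** (the assembly restated with the member objects supplied): from
`MemberRel`, the crux hypotheses, the pane tower and an admissible `μ`, the coverage clause implies
`SatakeOut` (fact-free). [folklore] -/
theorem satakeOut_of_memberRel {F₀ F : Type} [Field F₀] [NumberField F₀] [Field F] [NumberField F]
    [Algebra F₀ F] {τ : F ≃ₐ[F₀] F} {n : ℕ} {hcpt : isCompact_glFiniteIntegralLevel n F}
    {π : CuspidalAutomorphicRepData n F hcpt} {e : FramedGaloisRep F₀ ℂ 1} {k : ℤ} {ℓ : ℕ} [Fact ℓ.Prime]
    (ι : PadicAlgCl ℓ ≃+* ℂ) {eψ : FramedGaloisRep F ℂ 1} (hH : Hyps τ n π e k ℓ eψ)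
    {K : Type} [Field K] [NumberField K] [Algebra F₀ K] {cK : K ≃ₐ[F₀] K} (h2K : Module.finrank F₀ K = 2)
    (hcK : cK ≠ 1) {L F' : Type} [Field L] [NumberField L] [Field F'] [NumberField F'] [Algebra F₀ L]
    [Algebra F L] [Algebra K L] [Algebra F' L] [IsScalarTower F₀ F L] [IsScalarTower F₀ K L] [IsGalois K L]
    {s : L ≃ₐ[F'] L} (hT : IsPaneTower τ cK L F' s) {μ χe : HeckeCharacter F₀} {ω : HeckeCharacter F}
    {hfin : ω.IsFiniteOrder} {ω₀ : HeckeCharacter F₀} {ψu νk ν : HeckeCharacter K}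
    {Pind : CuspidalAutomorphicRepData (2 * n) F₀ (isCompact_glFiniteIntegralLevel_holds (2 * n) F₀)}
    {PiK τ' : CuspidalAutomorphicRepData (2 * n) K (isCompact_glFiniteIntegralLevel_holds (2 * n) K)}
    {P₀ P : CuspidalAutomorphicRepData n L (isCompact_glFiniteIntegralLevel_holds n L)} (hμ : MuHyp F K μ)
    (hrel : MemberRel π e eψ k μ χe ω hfin ω₀ ψu νk ν Pind PiK τ' P₀ P)
    (hcov : ∀ (v : HeightOneSpectrum (𝓞 F₀)) (α : HeightOneSpectrum (𝓞 F) → Multiset ℂ)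
      (c : HeightOneSpectrum (𝓞 F) → ℂ), Guard π eψ v α c → (v.asIdeal.primesOver (𝓞 K)).ncard = 2 →
      ∃ u : HeightOneSpectrum (𝓞 K), u.under (𝓞 F₀) = v ∧ (ψu * νk * ν).IsUnramifiedAt u ∧
        ∃ β : Multiset ℂ, τ'.1.HasSatakeParamAt u β ∧
          arithFrobPolyOfSatake ι u.residueCard (2 * n)
              (β.map (fun b ↦ b * ((ψu * νk * ν).valueAtUniformizer u)⁻¹)) = hostPoly ι n α c v) :
    SatakeOut F₀ π ι eψ cK s τ'.1 (ψu * νk * ν) P.1 := by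
  obtain ⟨hχe, -, hω, hω₀, -, -, hψures, hνk, hν, hAIae, hBCae, hτ'W, hτ'W', hP₀BC, hPW, hPW'⟩ := hrel
  obtain ⟨-, hdeg, hτ, -, hpol, -⟩ := hH
  exact ⟨⟨memberDict_ae π eψ ι hfin hω hνk hν hAIae hBCae hτ'W hτ'W', hcov⟩,
    isConjSelfDualAE_tau hdeg hτ h2K hcK π e k hpol hfin hχe hω₀ hμ hψures hνk hAIae hBCae hτ'W hτ'W',
    isConjSelfDualAE_pane hdeg hτ h2K hcK hT π e k hpol hfin hχe hω₀ hμ hψures hνk hAIae hBCae hτ'W hτ'W'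
      hP₀BC hPW hPW',
    isAutomorphicInductionAlong_pane hdeg hτ h2K hcK hT π e k hpol hfin hχe hω₀ hμ hψures hAIae hBCae
      hτ'W hτ'W' hP₀BC hPW hPW'⟩

end Summit.Langlands.Langlands.Theorems.HostInducedRep.OneTransparentPane

end
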